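import Literature.Topology.FourManifolds.SmoothMax
import Literature.Topology.FourManifolds.RegularFamilyIsotopy
import Mathlib.Analysis.SpecialFunctions.SmoothTransition
import Mathlib.Analysis.SpecialFunctions.Sqrt
import Mathlib.Analysis.InnerProductSpace.Calculus
import Mathlib.Analysis.InnerProductSpace.Dual
import Mathlib.Geometry.Manifold.Diffeomorph
import HarnessLib

/-!
# The flat-faced model ball

Topic `Literature/Topology/FourManifolds`; the model of a *capped ball* for the exp-height line
of the fact seat `provefact-Literature.Topology.FourManifolds.SphereEmbedding.schoenflies_exists_ball`
(Alexander's theorem, Schultens (2014), Thm. 3.2.5).  **Everything in this file is proved; no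
definitions, no named facts.**

In Alexander's argument a ball `B` bounded by a level disc `D` and a disc of the sphere has to
be pushed across `D` (Schultens (2014), Lemma 3.2.3).  On the level of regions this is the
absorption of a capped region `(B; D)` — `B` hanging below the flat face `D` — whose rounding is
known to be a ball; comparing it with a *model* capped ball reduces the absorption to the
sweep lemma (`SweepLemma.lean`).  The model must be an embedded ball with a genuinely **flat** face on
which alone the outward normal is vertical; this file builds it by shearing the round ball.

For a unit vector `u` and radii `0 < r₀ < r₁ < 1` put `c₀ = √(1 - r₀²)`, `q(x) = ‖x‖² - ⟪u, x⟫²`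
and `s(x) = σ(q(x))` with the profile
`σ(q) = (1 - λ((q - r₀²)/(r₁² - r₀²))) (√(1 - q) - c₀)` (`λ` Mathlib's `Real.smoothTransition`):

* §2 the profile: smooth on `ℝ` (`profile_contDiff`), `= √(1 - q) - c₀` for `q ≤ r₀²`, `= 0`
  for `q ≥ r₁²`, the top height `√(1 - q) - σ(q) ≤ c₀` with equality only for `q ≤ r₀²`
  (`sqrt_sub_profile_le`), and the derivative bound `σ' ≥ -(1 - λ)/(2√(1 - q))`
  (`deriv_profile_ge`);
* `FlatFaceModel.exists_model` — the shear `Ψ x = x - s(x) u` is a diffeomorphism of `E`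
  (inverse `x + s(x) u`); `M₀ = Ψ(𝔻) = {‖x + s(x) u‖ ≤ 1}`, `∂M₀ = Ψ(𝕊) = {‖x + s(x) u‖ = 1}`;
  `M₀` lies in `{⟪u, ·⟫ ≤ c₀}` and meets the level `{⟪u, ·⟫ = c₀}` exactly in the flat face
  `F₀ = {⟪u, x⟫ = c₀, q(x) ≤ r₀²} ⊆ ∂M₀`;
* `FlatFaceModel.model_normal` — the defining function `g₀ x = ‖x + s(x) u‖² - 1` is regular on
  `∂M₀`, and `Dg₀` is a positive multiple of `⟪u, ·⟫` (outward normal `+u`) only on `F₀`.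

Hence `(M₀; F₀)` is a capped region in the sense of `SweepBelowLevel.lean` (for `-u`), swept by
the height `1 + ⟪u, ·⟫ - c₀` itself, and presented as an embedded ball by `Ψ`.

## References

* J. Schultens, *Introduction to 3-Manifolds*, GSM 151 (2014), Lemma 3.2.3 and Thm. 3.2.5
  (PDF pp. 42–45). [Schultens2014]
* M. W. Hirsch, *Differential Topology*, GTM 33 (1976), Ch. 8 §3 (disc theorem). [HirschDT1976]
-/

open scoped RealInnerProductSpace Topology Manifold ContDiff
open Set Filter Metric Function

noncomputable section

namespace Literature.Topology.FourManifolds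

namespace FlatFaceModel

variable {E : Type*} [NormedAddCommGroup E] [InnerProductSpace ℝ E]

/-! ### §1 The horizontal square norm `‖x‖² - ⟪u, x⟫²` -/

/-- For a unit vector `u`, `‖x‖² - ⟪u, x⟫² = ‖x - ⟪u, x⟫ u‖² ≥ 0`. [folklore] -/
theorem hsq_eq_norm_sub_sq {u : E} (hu : ‖u‖ = 1) (x : E) :
    ‖x‖ ^ 2 - ⟪u, x⟫ ^ 2 = ‖x - ⟪u, x⟫ • u‖ ^ 2 := by
  rw [@norm_sub_sq_real, norm_smul, hu, mul_one, Real.norm_eq_abs, sq_abs, inner_smul_right,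
    real_inner_comm, real_inner_comm u x]
  ring

/-- The horizontal square norm is invariant under vertical translation. [folklore] -/
theorem hsq_add_smul {u : E} (hu : ‖u‖ = 1) (x : E) (t : ℝ) :
    ‖x + t • u‖ ^ 2 - ⟪u, x + t • u⟫ ^ 2 = ‖x‖ ^ 2 - ⟪u, x⟫ ^ 2 := by
  rw [@norm_add_sq_real, inner_add_right, inner_smul_right, inner_smul_right,
    real_inner_self_eq_norm_sq, hu, norm_smul, hu, Real.norm_eq_abs, mul_one, sq_abs,
    real_inner_comm u x]
  ring

/-- The horizontal square norm is smooth. [folklore] -/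
theorem contDiff_hsq (u : E) : ContDiff ℝ ∞ fun x : E => ‖x‖ ^ 2 - ⟪u, x⟫ ^ 2 :=
  (contDiff_norm_sq ℝ).sub ((contDiff_const.inner ℝ contDiff_id).pow 2)

/-- On the unit sphere, `⟪u, x⟫² = 1 - (‖x‖² - ⟪u, x⟫²)`. [folklore] -/
theorem inner_sq_eq_of_norm_eq_one {u x : E} (hx : ‖x‖ = 1) :
    ⟪u, x⟫ ^ 2 = 1 - (‖x‖ ^ 2 - ⟪u, x⟫ ^ 2) := by
  rw [hx]; ring

/-! ### §2 The profile `σ(q) = (1 - λ((q - r₀²)/(r₁² - r₀²))) (√(1 - q) - √(1 - r₀²))` -/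

section Profile

variable {r₀ r₁ : ℝ}

/-- The cutoff `λ((q - r₀²)/(r₁² - r₀²))` vanishes for `q ≤ r₀²`. [folklore] -/
theorem cut_eq_zero (h0 : 0 < r₀) (h01 : r₀ < r₁) {q : ℝ} (hq : q ≤ r₀ ^ 2) :
    Real.smoothTransition ((q - r₀ ^ 2) / (r₁ ^ 2 - r₀ ^ 2)) = 0 := by
  have h : r₀ ^ 2 < r₁ ^ 2 := by nlinarith
  exact Real.smoothTransition.zero_of_nonpos (div_nonpos_of_nonpos_of_nonneg (by linarith) (by linarith))

/-- The cutoff equals `1` for `q ≥ r₁²`. [folklore] -/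
theorem cut_eq_one (h0 : 0 < r₀) (h01 : r₀ < r₁) {q : ℝ} (hq : r₁ ^ 2 ≤ q) :
    Real.smoothTransition ((q - r₀ ^ 2) / (r₁ ^ 2 - r₀ ^ 2)) = 1 := by
  have h : r₀ ^ 2 < r₁ ^ 2 := by nlinarith
  exact Real.smoothTransition.one_of_one_le ((one_le_div (by linarith)).2 (by linarith))

/-- The cutoff is smooth with nonnegative derivative. [folklore] -/
theorem cut_contDiff_deriv_nonneg (h0 : 0 < r₀) (h01 : r₀ < r₁) :
    ContDiff ℝ ∞ (fun q : ℝ => Real.smoothTransition ((q - r₀ ^ 2) / (r₁ ^ 2 - r₀ ^ 2))) ∧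
      ∀ q, 0 ≤ deriv (fun q : ℝ => Real.smoothTransition ((q - r₀ ^ 2) / (r₁ ^ 2 - r₀ ^ 2))) q := by
  have h : r₀ ^ 2 < r₁ ^ 2 := by nlinarith
  refine ⟨Real.smoothTransition.contDiff.comp ((contDiff_id.sub contDiff_const).div_const _),
    fun q => Monotone.deriv_nonneg fun a b hab => Real.smoothTransition.monotone ?_⟩
  exact div_le_div_of_nonneg_right (by linarith) (by linarith)

/-- **The profile is smooth on all of `ℝ`**: on `q < 1` it is a product of smooth functions,
and on `q > r₁²` it vanishes identically (the two open sets cover `ℝ` since `r₁ < 1`).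
[folklore] -/
theorem profile_contDiff (h0 : 0 < r₀) (h01 : r₀ < r₁) (h1 : r₁ < 1) :
    ContDiff ℝ ∞ fun q : ℝ => (1 - Real.smoothTransition ((q - r₀ ^ 2) / (r₁ ^ 2 - r₀ ^ 2))) *
      (Real.sqrt (1 - q) - Real.sqrt (1 - r₀ ^ 2)) := by
  have hr1 : r₁ ^ 2 < 1 := by nlinarith
  obtain ⟨hcut, -⟩ := cut_contDiff_deriv_nonneg h0 h01
  rw [contDiff_iff_contDiffAt]
  intro q
  by_cases hq : q < 1
  · exact ((contDiffAt_const.sub hcut.contDiffAt).mul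
      (((contDiffAt_const.sub contDiffAt_id).sqrt (by simp; linarith)).sub contDiffAt_const))
  · -- near `q`, the first factor vanishes
    push Not at hq
    have hev : (fun q : ℝ => (1 - Real.smoothTransition ((q - r₀ ^ 2) / (r₁ ^ 2 - r₀ ^ 2))) *
        (Real.sqrt (1 - q) - Real.sqrt (1 - r₀ ^ 2))) =ᶠ[𝓝 q] fun _ => 0 := by
      filter_upwards [Ioi_mem_nhds (show r₁ ^ 2 < q by linarith)] with p hp
      rw [cut_eq_one h0 h01 (le_of_lt hp), sub_self, zero_mul]
    exact contDiffAt_const.congr_of_eventuallyEq hev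

/-- The profile vanishes for `q ≥ r₁²`. [folklore] -/
theorem profile_eq_zero (h0 : 0 < r₀) (h01 : r₀ < r₁) {q : ℝ} (hq : r₁ ^ 2 ≤ q) :
    (1 - Real.smoothTransition ((q - r₀ ^ 2) / (r₁ ^ 2 - r₀ ^ 2))) *
      (Real.sqrt (1 - q) - Real.sqrt (1 - r₀ ^ 2)) = 0 := by
  rw [cut_eq_one h0 h01 hq, sub_self, zero_mul]

/-- The profile is `√(1 - q) - √(1 - r₀²)` for `q ≤ r₀²`. [folklore] -/
theorem profile_eq_of_le (h0 : 0 < r₀) (h01 : r₀ < r₁) {q : ℝ} (hq : q ≤ r₀ ^ 2) :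
    (1 - Real.smoothTransition ((q - r₀ ^ 2) / (r₁ ^ 2 - r₀ ^ 2))) *
      (Real.sqrt (1 - q) - Real.sqrt (1 - r₀ ^ 2)) = Real.sqrt (1 - q) - Real.sqrt (1 - r₀ ^ 2) := by
  rw [cut_eq_zero h0 h01 hq, sub_zero, one_mul]

/-- **The top height** `√(1 - q) - σ(q) = λ √(1 - q) + (1 - λ) √(1 - r₀²)` is `≤ √(1 - r₀²)`,
with equality only if `q ≤ r₀²` (for `q ≤ 1`). [folklore] -/
theorem sqrt_sub_profile_le (h0 : 0 < r₀) (h01 : r₀ < r₁) {q : ℝ} (hq1 : q ≤ 1) :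
    Real.sqrt (1 - q) - (1 - Real.smoothTransition ((q - r₀ ^ 2) / (r₁ ^ 2 - r₀ ^ 2))) *
      (Real.sqrt (1 - q) - Real.sqrt (1 - r₀ ^ 2)) ≤ Real.sqrt (1 - r₀ ^ 2) ∧
    (Real.sqrt (1 - q) - (1 - Real.smoothTransition ((q - r₀ ^ 2) / (r₁ ^ 2 - r₀ ^ 2))) *
      (Real.sqrt (1 - q) - Real.sqrt (1 - r₀ ^ 2)) = Real.sqrt (1 - r₀ ^ 2) → q ≤ r₀ ^ 2) := by
  set l := Real.smoothTransition ((q - r₀ ^ 2) / (r₁ ^ 2 - r₀ ^ 2)) with hl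
  have hl0 : 0 ≤ l := Real.smoothTransition.nonneg _
  have hl1 : l ≤ 1 := Real.smoothTransition.le_one _
  have key : Real.sqrt (1 - q) - (1 - l) * (Real.sqrt (1 - q) - Real.sqrt (1 - r₀ ^ 2)) =
      Real.sqrt (1 - r₀ ^ 2) + l * (Real.sqrt (1 - q) - Real.sqrt (1 - r₀ ^ 2)) := by ring
  rw [key]
  by_cases hq : q ≤ r₀ ^ 2
  · have : l = 0 := cut_eq_zero h0 h01 hq
    simp [this, hq]
  · push Not at hq
    have hlt : Real.sqrt (1 - q) < Real.sqrt (1 - r₀ ^ 2) :=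
      Real.sqrt_lt_sqrt (by linarith) (by linarith)
    have hlpos : 0 < l := Real.smoothTransition.pos_of_pos (div_pos (by linarith) (by nlinarith))
    constructor
    · nlinarith
    · intro h; nlinarith

/-- The derivative of the cutoff vanishes for `q ≤ r₀²` (the smooth transition is flat at
`0`). [folklore] -/
theorem deriv_cut_eq_zero (h0 : 0 < r₀) (h01 : r₀ < r₁) {q : ℝ} (hq : q ≤ r₀ ^ 2) :
    deriv (fun q : ℝ => Real.smoothTransition ((q - r₀ ^ 2) / (r₁ ^ 2 - r₀ ^ 2))) q = 0 := by
  have h : r₀ ^ 2 < r₁ ^ 2 := by nlinarith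
  have haff : HasDerivAt (fun q : ℝ => (q - r₀ ^ 2) / (r₁ ^ 2 - r₀ ^ 2)) (1 / (r₁ ^ 2 - r₀ ^ 2)) q := by
    simpa using ((hasDerivAt_id q).sub_const (r₀ ^ 2)).div_const (r₁ ^ 2 - r₀ ^ 2)
  have hST : HasDerivAt Real.smoothTransition
      (deriv Real.smoothTransition ((q - r₀ ^ 2) / (r₁ ^ 2 - r₀ ^ 2))) ((q - r₀ ^ 2) / (r₁ ^ 2 - r₀ ^ 2)) :=
    ((Real.smoothTransition.contDiff (n := 1)).differentiable one_ne_zero _).hasDerivAt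
  have hc0 := hST.comp q haff
  have hc : HasDerivAt (fun q : ℝ => Real.smoothTransition ((q - r₀ ^ 2) / (r₁ ^ 2 - r₀ ^ 2)))
      (deriv Real.smoothTransition ((q - r₀ ^ 2) / (r₁ ^ 2 - r₀ ^ 2)) * (1 / (r₁ ^ 2 - r₀ ^ 2))) q :=
    hc0
  rw [hc.deriv, RegularFamily.deriv_smoothTransition_eq_zero, zero_mul]
  exact Or.inl (div_nonpos_of_nonpos_of_nonneg (by linarith) (by linarith))

/-- **Derivative of the profile** for `q < 1`:
`σ' = -λ' (√(1 - q) - c₀) - (1 - λ)/(2 √(1 - q))`. [folklore] -/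
theorem hasDerivAt_profile (h0 : 0 < r₀) (h01 : r₀ < r₁) {q : ℝ} (hq : q < 1) :
    HasDerivAt (fun q : ℝ => (1 - Real.smoothTransition ((q - r₀ ^ 2) / (r₁ ^ 2 - r₀ ^ 2))) *
        (Real.sqrt (1 - q) - Real.sqrt (1 - r₀ ^ 2)))
      (-(deriv (fun q : ℝ => Real.smoothTransition ((q - r₀ ^ 2) / (r₁ ^ 2 - r₀ ^ 2))) q) *
          (Real.sqrt (1 - q) - Real.sqrt (1 - r₀ ^ 2)) +
        (1 - Real.smoothTransition ((q - r₀ ^ 2) / (r₁ ^ 2 - r₀ ^ 2))) *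
          (-(1 / (2 * Real.sqrt (1 - q))))) q := by
  obtain ⟨hcut, -⟩ := cut_contDiff_deriv_nonneg h0 h01
  have hL : HasDerivAt (fun q : ℝ => Real.smoothTransition ((q - r₀ ^ 2) / (r₁ ^ 2 - r₀ ^ 2)))
      (deriv (fun q : ℝ => Real.smoothTransition ((q - r₀ ^ 2) / (r₁ ^ 2 - r₀ ^ 2))) q) q :=
    ((hcut.differentiable (by simp)) q).hasDerivAt
  have h1 : HasDerivAt (fun q : ℝ => 1 - q) (-1) q := (hasDerivAt_id q).const_sub 1
  have hR : HasDerivAt (fun q : ℝ => Real.sqrt (1 - q)) (1 / (2 * Real.sqrt (1 - q)) * (-1)) q :=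
    (Real.hasDerivAt_sqrt (show 1 - q ≠ 0 by linarith)).comp q h1
  have := ((hasDerivAt_const q (1 : ℝ)).sub hL).mul (hR.sub_const (Real.sqrt (1 - r₀ ^ 2)))
  refine this.congr_deriv ?_
  simp only [Pi.sub_apply]
  ring

/-- **The profile's derivative is not too negative**: for `q < 1`,
`q > 0`... precisely `σ'(q) ≥ -(1 - λ(q))/(2 √(1 - q))`. [folklore] -/
theorem deriv_profile_ge (h0 : 0 < r₀) (h01 : r₀ < r₁) {q : ℝ} (hq : q < 1) :
    -((1 - Real.smoothTransition ((q - r₀ ^ 2) / (r₁ ^ 2 - r₀ ^ 2))) / (2 * Real.sqrt (1 - q))) ≤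
      deriv (fun q : ℝ => (1 - Real.smoothTransition ((q - r₀ ^ 2) / (r₁ ^ 2 - r₀ ^ 2))) *
        (Real.sqrt (1 - q) - Real.sqrt (1 - r₀ ^ 2))) q := by
  rw [(hasDerivAt_profile h0 h01 hq).deriv]
  obtain ⟨-, hnonneg⟩ := cut_contDiff_deriv_nonneg h0 h01 (r₁ := r₁)
  have hterm : 0 ≤ -(deriv (fun q : ℝ => Real.smoothTransition ((q - r₀ ^ 2) / (r₁ ^ 2 - r₀ ^ 2))) q) *
      (Real.sqrt (1 - q) - Real.sqrt (1 - r₀ ^ 2)) := by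
    by_cases hq0 : q ≤ r₀ ^ 2
    · rw [deriv_cut_eq_zero h0 h01 hq0, neg_zero, zero_mul]
    · push Not at hq0
      have hle : Real.sqrt (1 - q) ≤ Real.sqrt (1 - r₀ ^ 2) := Real.sqrt_le_sqrt (by linarith)
      have := hnonneg q
      nlinarith
  have hsqrt : 0 < Real.sqrt (1 - q) := Real.sqrt_pos.2 (by linarith)
  have hid : (1 - Real.smoothTransition ((q - r₀ ^ 2) / (r₁ ^ 2 - r₀ ^ 2))) *
      -(1 / (2 * Real.sqrt (1 - q))) =
      -((1 - Real.smoothTransition ((q - r₀ ^ 2) / (r₁ ^ 2 - r₀ ^ 2))) / (2 * Real.sqrt (1 - q))) := by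
    ring
  linarith

end Profile

/-! ### §3 The shear and the model -/

section Model

/-- **The flat-faced model ball.**  For a unit vector `u` and radii `0 < r₀ < r₁ < 1` put
`c₀ = √(1 - r₀²)`, `q(x) = ‖x‖² - ⟪u, x⟫²` (horizontal square norm),
`s(x) = (1 - λ((q(x) - r₀²)/(r₁² - r₀²))) (√(1 - q(x)) - c₀)` and `Ψ x = x - s(x) u`: a shear
along `u` (a diffeomorphism, inverse `x + s(x) u`, since `s` only depends on the horizontal
part).  The model `M₀ = Ψ(𝔻)` = `{‖x + s(x) u‖ ≤ 1}` is an embedded ball lying below the level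
`{⟪u, ·⟫ = c₀}` and touching it exactly in the flat face `F₀ = {⟪u, x⟫ = c₀, q(x) ≤ r₀²}`,
which is part of `∂M₀ = Ψ(𝕊) = {‖x + s(x) u‖ = 1}`; the top of `M₀` is the graph of
`λ √(1 - q) + (1 - λ) c₀ ≤ c₀` over the horizontal disc.  This theorem packages the shear and
these elementary facts. [folklore] -/
theorem exists_model {u : E} (hu : ‖u‖ = 1) {r₀ r₁ : ℝ} (h0 : 0 < r₀) (h01 : r₀ < r₁)
    (h1 : r₁ < 1) :
    ∃ Ψ : E ≃ₘ⟮𝓘(ℝ, E), 𝓘(ℝ, E)⟯ E, ∃ s : E → ℝ, ContDiff ℝ ∞ s ∧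
      (∀ x, s x = (1 - Real.smoothTransition ((‖x‖ ^ 2 - ⟪u, x⟫ ^ 2 - r₀ ^ 2) / (r₁ ^ 2 - r₀ ^ 2))) *
        (Real.sqrt (1 - (‖x‖ ^ 2 - ⟪u, x⟫ ^ 2)) - Real.sqrt (1 - r₀ ^ 2))) ∧
      (∀ x, Ψ x = x - s x • u) ∧ (∀ x, Ψ.symm x = x + s x • u) ∧
      (∀ x (t : ℝ), s (x + t • u) = s x) ∧
      Ψ '' closedBall (0 : E) 1 = {x | ‖x + s x • u‖ ≤ 1} ∧
      Ψ '' sphere (0 : E) 1 = {x | ‖x + s x • u‖ = 1} ∧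
      (∀ x, ‖x + s x • u‖ ≤ 1 → ⟪u, x⟫ ≤ Real.sqrt (1 - r₀ ^ 2)) ∧
      (∀ x, ‖x + s x • u‖ ≤ 1 → ⟪u, x⟫ = Real.sqrt (1 - r₀ ^ 2) →
        ‖x‖ ^ 2 - ⟪u, x⟫ ^ 2 ≤ r₀ ^ 2 ∧ ‖x + s x • u‖ = 1) ∧
      (∀ x, ⟪u, x⟫ = Real.sqrt (1 - r₀ ^ 2) → ‖x‖ ^ 2 - ⟪u, x⟫ ^ 2 ≤ r₀ ^ 2 →
        ‖x + s x • u‖ = 1) := by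
  have hr0 : r₀ ^ 2 < 1 := by nlinarith
  have hc₀ : 0 < Real.sqrt (1 - r₀ ^ 2) := Real.sqrt_pos.2 (by linarith)
  have hc₀sq : Real.sqrt (1 - r₀ ^ 2) ^ 2 = 1 - r₀ ^ 2 := Real.sq_sqrt (by linarith)
  -- the profile and the shift
  set σ : ℝ → ℝ := fun q => (1 - Real.smoothTransition ((q - r₀ ^ 2) / (r₁ ^ 2 - r₀ ^ 2))) *
    (Real.sqrt (1 - q) - Real.sqrt (1 - r₀ ^ 2)) with hσ
  have hσs : ContDiff ℝ ∞ σ := profile_contDiff h0 h01 h1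
  set hsq : E → ℝ := fun x => ‖x‖ ^ 2 - ⟪u, x⟫ ^ 2 with hhsq
  set s : E → ℝ := fun x => σ (hsq x) with hs
  have hss : ContDiff ℝ ∞ s := hσs.comp (contDiff_hsq u)
  have hs_add : ∀ x (t : ℝ), s (x + t • u) = s x := fun x t => by
    simp only [hs, hhsq, hsq_add_smul hu]
  -- the shear as a diffeomorphism
  have hΨs : ContDiff ℝ ∞ fun x : E => x - s x • u := contDiff_id.sub (hss.smul contDiff_const)
  have hΨis : ContDiff ℝ ∞ fun x : E => x + s x • u := contDiff_id.add (hss.smul contDiff_const)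
  have hleft : ∀ x : E, (x - s x • u) + s (x - s x • u) • u = x := fun x => by
    have := hs_add x (-s x)
    rw [neg_smul, ← sub_eq_add_neg] at this
    rw [this, sub_add_cancel]
  have hright : ∀ x : E, (x + s x • u) - s (x + s x • u) • u = x := fun x => by
    rw [hs_add, add_sub_cancel_right]
  let Ψ : E ≃ₘ⟮𝓘(ℝ, E), 𝓘(ℝ, E)⟯ E :=
    { toFun := fun x => x - s x • u
      invFun := fun x => x + s x • u
      left_inv := hleft
      right_inv := hright
      contMDiff_toFun := hΨs.contMDiff
      contMDiff_invFun := hΨis.contMDiff }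
  have hΨ : ∀ x, Ψ x = x - s x • u := fun x => rfl
  have hΨsymm : ∀ x, Ψ.symm x = x + s x • u := fun x => rfl
  -- images as preimages under the inverse
  have himage : ∀ S : Set E, Ψ '' S = {x | x + s x • u ∈ S} := by
    intro S
    ext x
    constructor
    · rintro ⟨y, hy, rfl⟩
      show (y - s y • u) + s (y - s y • u) • u ∈ S
      rwa [hleft]
    · intro hx
      exact ⟨x + s x • u, hx, hright x⟩
  -- the key inequality on the vertical coordinate
  have hkey : ∀ x, ‖x + s x • u‖ ≤ 1 →
      ⟪u, x⟫ ≤ Real.sqrt (1 - r₀ ^ 2) ∧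
        (⟪u, x⟫ = Real.sqrt (1 - r₀ ^ 2) → hsq x ≤ r₀ ^ 2 ∧ ‖x + s x • u‖ = 1) := by
    intro x hx
    set y := x + s x • u with hy
    have hq : hsq y = hsq x := by simp only [hhsq, hy, hsq_add_smul hu]
    have hq1 : hsq x ≤ 1 := by
      have h1 : hsq y ≤ ‖y‖ ^ 2 := by simp only [hhsq]; nlinarith [sq_nonneg ⟪u, y⟫]
      have h2 : ‖y‖ ^ 2 ≤ 1 := by nlinarith [norm_nonneg y]
      linarith
    have hq0 : 0 ≤ hsq x := by
      simp only [hhsq]; rw [hsq_eq_norm_sub_sq hu]; positivity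
    -- `⟪u, y⟫ ≤ √(1 - q)`
    have huy : ⟪u, y⟫ ≤ Real.sqrt (1 - hsq x) := by
      have h1 : ⟪u, y⟫ ^ 2 ≤ 1 - hsq x := by
        have : ⟪u, y⟫ ^ 2 = ‖y‖ ^ 2 - hsq y := by simp only [hhsq]; ring
        rw [this, hq]; nlinarith [norm_nonneg y]
      calc ⟪u, y⟫ ≤ |⟪u, y⟫| := le_abs_self _
        _ = Real.sqrt (⟪u, y⟫ ^ 2) := (Real.sqrt_sq_eq_abs _).symm
        _ ≤ Real.sqrt (1 - hsq x) := Real.sqrt_le_sqrt h1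
    have huy' : ⟪u, y⟫ = ⟪u, x⟫ + s x := by
      simp only [hy, inner_add_right, inner_smul_right, real_inner_self_eq_norm_sq, hu]; ring
    have hsx : s x = σ (hsq x) := rfl
    obtain ⟨hle, heq⟩ := sqrt_sub_profile_le h0 h01 hq1 (r₁ := r₁)
    have hle' : Real.sqrt (1 - hsq x) - σ (hsq x) ≤ Real.sqrt (1 - r₀ ^ 2) := hle
    have heq' : Real.sqrt (1 - hsq x) - σ (hsq x) = Real.sqrt (1 - r₀ ^ 2) → hsq x ≤ r₀ ^ 2 := heq
    have hux : ⟪u, x⟫ = ⟪u, y⟫ - σ (hsq x) := by rw [huy', hsx]; ring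
    refine ⟨?_, fun hxeq => ?_⟩
    · rw [hux]; linarith
    · have h1 : Real.sqrt (1 - hsq x) - σ (hsq x) = Real.sqrt (1 - r₀ ^ 2) :=
        le_antisymm hle' (by linarith)
      have hqr : hsq x ≤ r₀ ^ 2 := heq' h1
      refine ⟨hqr, ?_⟩
      -- `⟪u, y⟫ = √(1 - q)` forces `‖y‖ = 1`
      have huyeq : ⟪u, y⟫ = Real.sqrt (1 - hsq x) := by
        apply le_antisymm huy
        rw [hux] at hxeq; linarith
      have hn : ‖y‖ ^ 2 = 1 := by
        have : ‖y‖ ^ 2 = hsq y + ⟪u, y⟫ ^ 2 := by simp only [hhsq]; ring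
        rw [this, hq, huyeq, Real.sq_sqrt (by linarith)]
        ring
      have := norm_nonneg y
      nlinarith
  refine ⟨Ψ, s, hss, fun x => rfl, hΨ, hΨsymm, hs_add, ?_, ?_, fun x hx => (hkey x hx).1,
    fun x hx hxeq => (hkey x hx).2 hxeq, fun x hxeq hq => ?_⟩
  · rw [himage]; ext x; simp [mem_closedBall, dist_zero_right]
  · rw [himage]; ext x; simp
  · -- the face lies on the boundary sphere
    set y := x + s x • u with hy
    have hq' : hsq y = hsq x := by simp only [hhsq, hy, hsq_add_smul hu]
    have hsx : s x = Real.sqrt (1 - hsq x) - Real.sqrt (1 - r₀ ^ 2) :=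
      profile_eq_of_le h0 h01 hq
    have huy : ⟪u, y⟫ = Real.sqrt (1 - hsq x) := by
      simp only [hy, inner_add_right, inner_smul_right, real_inner_self_eq_norm_sq, hu, hsx,
        hxeq]; ring
    have hq0 : 0 ≤ hsq x := by
      simp only [hhsq]; rw [hsq_eq_norm_sub_sq hu]; positivity
    have hn : ‖y‖ ^ 2 = 1 := by
      have : ‖y‖ ^ 2 = hsq y + ⟪u, y⟫ ^ 2 := by simp only [hhsq]; ring
      rw [this, hq', huy, Real.sq_sqrt (by nlinarith)]
      ring
    have := norm_nonneg y
    nlinarith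

/-- **Regularity and the outward normal of the model.**  With `s` the shift of
`exists_model` and `g₀ x = ‖x + s(x) u‖² - 1` the defining function of the model `M₀`
(`M₀ = {g₀ ≤ 0}`, `∂M₀ = {g₀ = 0}`): `Dg₀ ≠ 0` on `∂M₀`, and `Dg₀(x)` is a positive multiple of
`⟪u, ·⟫` — the outward normal is `+u` — only at points of the flat face
`{⟪u, x⟫ = √(1 - r₀²), ‖x‖² - ⟪u, x⟫² ≤ r₀²}`.  (At `x` with `y = x + s(x) u` on the unit sphere,
`Dg₀(x) u = 2⟪u, y⟫` and `Dg₀(x) x_h = 2q(1 + 2σ'(q)⟪u, y⟫)`, `q = ‖x‖² - ⟪u, x⟫²`; the bound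
`σ' ≥ -(1 - λ)/(2√(1 - q))` forces `λ(q) = 0`.) [folklore] -/
theorem model_normal {u : E} (hu : ‖u‖ = 1) {r₀ r₁ : ℝ} (h0 : 0 < r₀) (h01 : r₀ < r₁)
    (h1 : r₁ < 1) {s : E → ℝ}
    (hs : ∀ x, s x = (1 - Real.smoothTransition ((‖x‖ ^ 2 - ⟪u, x⟫ ^ 2 - r₀ ^ 2) / (r₁ ^ 2 - r₀ ^ 2))) *
        (Real.sqrt (1 - (‖x‖ ^ 2 - ⟪u, x⟫ ^ 2)) - Real.sqrt (1 - r₀ ^ 2))) :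
    (∀ x, ‖x + s x • u‖ = 1 → fderiv ℝ (fun y => ‖y + s y • u‖ ^ 2 - 1) x ≠ 0) ∧
    (∀ x, ‖x + s x • u‖ = 1 → ∀ c : ℝ, 0 < c →
      fderiv ℝ (fun y => ‖y + s y • u‖ ^ 2 - 1) x = c • innerSL ℝ u →
        ⟪u, x⟫ = Real.sqrt (1 - r₀ ^ 2) ∧ ‖x‖ ^ 2 - ⟪u, x⟫ ^ 2 ≤ r₀ ^ 2) := by
  have hr0 : r₀ ^ 2 < 1 := by nlinarith
  set σ : ℝ → ℝ := fun q => (1 - Real.smoothTransition ((q - r₀ ^ 2) / (r₁ ^ 2 - r₀ ^ 2))) *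
    (Real.sqrt (1 - q) - Real.sqrt (1 - r₀ ^ 2)) with hσ
  have hσs : ContDiff ℝ ∞ σ := profile_contDiff h0 h01 h1
  set hsq : E → ℝ := fun x => ‖x‖ ^ 2 - ⟪u, x⟫ ^ 2 with hhsq
  have hs' : s = fun x => σ (hsq x) := funext fun x => by rw [hs x]
  -- the derivative at a point, evaluated on `u` and on the horizontal part `x_h`
  have hD : ∀ x, ∃ D : E →L[ℝ] ℝ, HasFDerivAt (fun y => ‖y + s y • u‖ ^ 2 - 1) D x ∧
      D u = 2 * ⟪u, x + s x • u⟫ ∧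
      D (x - ⟪u, x⟫ • u) = 2 * hsq x * (1 + 2 * deriv σ (hsq x) * ⟪u, x + s x • u⟫) := by
    intro x
    set y := x + s x • u with hy
    -- `hsq`
    have hq : HasFDerivAt hsq (2 • innerSL ℝ x - (2 * ⟪u, x⟫) • innerSL ℝ u) x := by
      have h1 : HasFDerivAt (fun x : E => ‖x‖ ^ 2) (2 • innerSL ℝ x) x :=
        (hasStrictFDerivAt_norm_sq x).hasFDerivAt
      have h2 : HasFDerivAt (fun x : E => ⟪u, x⟫ ^ 2) ((2 * ⟪u, x⟫) • innerSL ℝ u) x := by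
        have := ((innerSL ℝ u).hasFDerivAt (x := x)).pow 2
        refine this.congr_fderiv ?_
        ext w; simp [pow_one]
      exact h1.sub h2
    -- `s = σ ∘ hsq`
    have hσd : HasDerivAt σ (deriv σ (hsq x)) (hsq x) :=
      ((hσs.differentiable (by simp)) _).hasDerivAt
    have hsd : HasFDerivAt s ((deriv σ (hsq x)) • (2 • innerSL ℝ x - (2 * ⟪u, x⟫) • innerSL ℝ u)) x := by
      rw [hs']
      have := hσd.hasFDerivAt.comp x hq
      refine this.congr_fderiv ?_
      ext w
      simp [mul_comm]
      ring
    -- `Y = id + s • u`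
    have hY : HasFDerivAt (fun y : E => y + s y • u)
        (ContinuousLinearMap.id ℝ E +
          ((deriv σ (hsq x)) • (2 • innerSL ℝ x - (2 * ⟪u, x⟫) • innerSL ℝ u)).smulRight u) x :=
      (hasFDerivAt_id x).add (hsd.smul_const u)
    -- `‖·‖² - 1`
    have hN : HasFDerivAt (fun z : E => ‖z‖ ^ 2 - 1) (2 • innerSL ℝ y) y :=
      (hasStrictFDerivAt_norm_sq y).hasFDerivAt.sub_const 1
    have hG := hN.comp x hY
    refine ⟨_, hG, ?_, ?_⟩
    · have hqu : (2 • innerSL ℝ x - (2 * ⟪u, x⟫) • innerSL ℝ u) u = 0 := by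
        simp [hu, real_inner_comm]
      simp only [ContinuousLinearMap.comp_apply, add_apply, ContinuousLinearMap.id_apply,
        ContinuousLinearMap.smulRight_apply, smul_apply, hqu, smul_eq_mul, mul_zero, zero_smul,
        add_zero, innerSL_apply_apply, real_inner_comm, nsmul_eq_mul, Nat.cast_ofNat]
    · have hxh : ⟪u, x - ⟪u, x⟫ • u⟫ = 0 := by
        simp [inner_sub_right, inner_smul_right, hu]
      have hxxh : ⟪x, x - ⟪u, x⟫ • u⟫ = hsq x := by
        simp only [hhsq, inner_sub_right, inner_smul_right, real_inner_self_eq_norm_sq,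
          real_inner_comm u x]; ring
      have hqxh : (2 • innerSL ℝ x - (2 * ⟪u, x⟫) • innerSL ℝ u) (x - ⟪u, x⟫ • u) = 2 * hsq x := by
        simp only [sub_apply, smul_apply, innerSL_apply_apply, hxxh, hxh, smul_eq_mul, mul_zero,
          sub_zero, nsmul_eq_mul, Nat.cast_ofNat]
      have hyxh : ⟪y, x - ⟪u, x⟫ • u⟫ = hsq x := by
        rw [hy, inner_add_left, inner_smul_left, hxxh, hxh]; simp
      simp only [ContinuousLinearMap.comp_apply, add_apply, ContinuousLinearMap.id_apply,
        ContinuousLinearMap.smulRight_apply, smul_apply, hqxh, smul_eq_mul, innerSL_apply_apply,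
        inner_add_right, inner_smul_right, hyxh, real_inner_comm,
        nsmul_eq_mul, Nat.cast_ofNat]
      ring
  -- common facts at a boundary point
  have hcommon : ∀ x, ‖x + s x • u‖ = 1 → ∀ c : ℝ,
      fderiv ℝ (fun y => ‖y + s y • u‖ ^ 2 - 1) x = c • innerSL ℝ u →
        c = 2 * ⟪u, x + s x • u⟫ ∧ hsq x * (1 + 2 * deriv σ (hsq x) * ⟪u, x + s x • u⟫) = 0 ∧
          hsq x + ⟪u, x + s x • u⟫ ^ 2 = 1 := by
    intro x hx c hc
    obtain ⟨D, hDf, hDu, hDh⟩ := hD x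
    have hDeq : D = c • innerSL ℝ u := by rw [← hDf.fderiv, hc]
    refine ⟨?_, ?_, ?_⟩
    · have := hDu
      rw [hDeq] at this
      simp [hu] at this
      linarith
    · have := hDh
      rw [hDeq] at this
      have hxh : ⟪u, x - ⟪u, x⟫ • u⟫ = 0 := by
        simp [inner_sub_right, inner_smul_right, hu]
      simp only [smul_apply, innerSL_apply_apply, hxh, smul_eq_mul, mul_zero] at this
      linarith
    · have h1 : hsq (x + s x • u) = hsq x := by simp only [hhsq, hsq_add_smul hu]
      have : ‖x + s x • u‖ ^ 2 = hsq (x + s x • u) + ⟪u, x + s x • u⟫ ^ 2 := by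
        simp only [hhsq]; ring
      rw [hx, h1] at this
      linarith
  refine ⟨fun x hx hD0 => ?_, fun x hx c hc hDc => ?_⟩
  · -- regularity
    obtain ⟨hc, hq, hn⟩ := hcommon x hx 0 (by rw [hD0, zero_smul])
    have huy : ⟪u, x + s x • u⟫ = 0 := by linarith
    rw [huy, mul_zero, add_zero, mul_one] at hq
    rw [hq, huy] at hn
    norm_num at hn
  · obtain ⟨hc', hq, hn⟩ := hcommon x hx c hDc
    set y := x + s x • u with hy
    have huy_pos : 0 < ⟪u, y⟫ := by linarith
    have hq0 : 0 ≤ hsq x := by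
      simp only [hhsq]; rw [hsq_eq_norm_sub_sq hu]; positivity
    have hq1 : hsq x < 1 := by nlinarith
    -- `⟪u, y⟫ = √(1 - q)`
    have huy : ⟪u, y⟫ = Real.sqrt (1 - hsq x) := by
      rw [← Real.sqrt_sq huy_pos.le]
      congr 1; linarith
    have hux : ⟪u, x⟫ = ⟪u, y⟫ - s x := by
      simp only [hy, inner_add_right, inner_smul_right, real_inner_self_eq_norm_sq, hu]; ring
    -- `q ≤ r₀²`
    have hqr : hsq x ≤ r₀ ^ 2 := by
      rcases mul_eq_zero.1 hq with h | h
      · rw [h]; positivity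
      · -- `1 + 2 σ' √(1 - q) = 0` against `σ' ≥ -(1 - λ)/(2 √(1 - q))`
        have hge := deriv_profile_ge h0 h01 hq1 (r₁ := r₁)
        set L := Real.smoothTransition ((hsq x - r₀ ^ 2) / (r₁ ^ 2 - r₀ ^ 2)) with hL
        have hL0 : 0 ≤ L := Real.smoothTransition.nonneg _
        have hsqrt : 0 < Real.sqrt (1 - hsq x) := Real.sqrt_pos.2 (by linarith)
        rw [huy] at h
        have hdσ : deriv σ (hsq x) = -(1 / (2 * Real.sqrt (1 - hsq x))) := by
          field_simp
          nlinarith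
        have hge' : -((1 - L) / (2 * Real.sqrt (1 - hsq x))) ≤ deriv σ (hsq x) := hge
        rw [hdσ] at hge'
        have hL1 : L ≤ 0 := by
          rw [neg_le_neg_iff, div_le_div_iff_of_pos_right (by positivity)] at hge'
          linarith
        have hLz : L = 0 := le_antisymm hL1 hL0
        have := Real.smoothTransition.zero_iff_nonpos.1 hLz
        have h01' : r₀ ^ 2 < r₁ ^ 2 := by nlinarith
        rw [div_nonpos_iff] at this
        rcases this with ⟨-, h'⟩ | ⟨h', -⟩
        · linarith
        · linarith
    refine ⟨?_, hqr⟩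
    have hsx : s x = Real.sqrt (1 - hsq x) - Real.sqrt (1 - r₀ ^ 2) := by
      rw [hs x]; exact profile_eq_of_le h0 h01 hqr
    rw [hux, huy, hsx]; ring

end Model

end FlatFaceModel

end Literature.Topology.FourManifolds

end
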